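import Literature.Geometry.Symplectic.SphereCROperatorLinearisation
import HarnessLib

/-!
# Sup-norm smallness: the chart Cauchy–Riemann operators at a general small point

Layer B7 infrastructure of the analytic core of the Hofer–Lizan–Sikorav local foliation theorem
(Wendl 2018, Thm. 2.46; lead of crux `WitnessCharge`, summit `SmoothPoincare4`). The smooth
Banach maps `PT`, `PN` of `SphereCROperatorBanach.lean` (tangent / normal pieces of the chart
Cauchy–Riemann operators on `SecPair k r = 𝓗^{k+1,r}_{-w²} × 𝓗^{k+1,r}_1`) are the HONEST
operators, and take values in the section spaces `𝓗T' = 𝓗^{k,r}_{dbarClutch (-w²)}`,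
`𝓗N' = 𝓗^{k,r}_{dbarClutch 1}`, as soon as the tangent section `ξ` of `y = (ξ, f)` is
POINTWISE small on the discs of radius `4` of both charts: `|ξ₀ z| < 1/4` for `‖z‖ ≤ 4` and
`|ξ₁ w| < 1/4` for `‖w‖ ≤ 4` (nondegeneracy of the exponential chart, the image avoids the
poles). This file records this level-independent (sup-norm) smallness condition `SmallPt` —
implied by the `C^{k+1,r}`-smallness `Small` of `SphereCROperatorBanach.lean`
(`smallPt_of_small`), satisfied by `0` (`smallPt_zero`), OPEN (`isOpen_smallPt`: a
`C^{k+1,r}`-perturbation of size `ε` moves both representatives by `≤ 16 ε` on the discs,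
`norm_sec₀_le_of_norm_le`) — and the `SmallPt` variants of the lead's lemmas, now at a GENERAL
small point `y` (not only at the zero section):

* `out₀_apply_of_smallPt`, `out₁_apply_of_smallPt`, `crOp₁_eq_of_smallPt`, `PT_mem_of_smallPt`,
  `PN_mem_of_smallPt` — the proofs of the `Small` versions verbatim (they only use the two
  pointwise bounds);
* `coe_FT_of_smallPt`, `contDiffOn_FT_smallPt` (and `FN`): the codomain-restricted operators
  `FT : SecPair k r → 𝓗T'`, `FN : SecPair k r → 𝓗N'` of `SphereCROperatorLinearisation.lean`
  are `PT`, `PN` and `C^∞` on the open set `{SmallPt}`;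
* `dPT_mem_of_smallPt`, `LTAt y hy := codRestrict (dPT y)`, `hasFDerivAt_FT_of_smallPt` (and
  `dPN_mem_of_smallPt`, `LNAt`, `hasFDerivAt_FN_of_smallPt`): the derivative of `FT` at a small
  point `y` is the codomain restriction of `dPT y` (values in the closed submodule `𝓗T'` because
  `PT` takes values there near `y`); at `y = 0` these are the lead's `LT`, `LN` (`LTAt_zero`).

## References

* C. Wendl, *Holomorphic Curves in Low Dimensions*, LNM 2216 (2018), §2.3, Thm. 2.46. [Wendl2018]
-/

noncomputable section

open Set Filter Metric Function Complex
open scoped Topology NNReal ContDiff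
open Literature.Analysis.FunctionSpaces Literature.Analysis.Complex.RiemannSphere
open Literature.Analysis.Complex.ProjectiveLineExpChart Literature.Geometry.Symplectic.CRExpression
open Literature.Analysis.Complex Literature.Analysis.Calculus

namespace Literature.Geometry.Symplectic

namespace SphereCR

namespace SphereACData

variable (𝒥 : SphereACData) {r : ℝ≥0} (hr : r ≤ 1) (k : ℕ)

/-! ### Sup-norm smallness -/

section SmallPt

variable {hr k}

/-- **Sup-norm smallness** of `y = (ξ, f) ∈ SecPair k r`: both chart representatives of the
tangent section `ξ` (clutching `-w²`) have modulus `< 1/4` on the closed discs of radius `4`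
(so the exponential chart is nondegenerate along the graph and the image avoids the poles). A
level-independent weakening of `Small`. [cite: Wendl2018, Thm. 2.46] -/
def SmallPt (y : SecPair k r) : Prop :=
  (∀ z : ℂ, ‖z‖ ≤ 4 → ‖sec₀ (fun w : ℂ => -w ^ 2) y.1.1 z‖ < 4⁻¹) ∧
    (∀ w : ℂ, ‖w‖ ≤ 4 → ‖sec₁ (fun w : ℂ => -w ^ 2) y.1.1 w‖ < 4⁻¹)

/-- `C^{k+1,r}`-small points (`Small`) are sup-norm small. [folklore] -/
theorem smallPt_of_small {y : SecPair k r} (hy : Small hr k y) : SmallPt y :=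
  ⟨fun _ hz => norm_sec₀_lt_of_small hy hz, fun _ hw => norm_sec₁_lt_of_small hy hw⟩

/-- The zero section is sup-norm small. [folklore] -/
theorem smallPt_zero : SmallPt (0 : SecPair k r) := by
  refine ⟨fun z _ => ?_, fun w _ => ?_⟩
  · rw [Prod.fst_zero, sec₀_coe_zero, norm_zero]
    norm_num
  · rw [Prod.fst_zero, sec₁_coe_zero, norm_zero]
    norm_num

/-- **Sup-norm control by the `C^{j,r}`-norm**, `z`-chart: on the disc `‖z‖ ≤ 4` the
`z`-representative (clutching `-w²`) of a pair of pieces `p` has modulus `≤ 16 ‖p‖`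
(`‖p.1 z‖ ≤ ‖p‖` on `‖z‖ < 2`, `‖z‖² ‖p.2 z⁻¹‖ ≤ 16 ‖p‖` outside). [folklore] -/
theorem norm_sec₀_le_of_norm_le {j : ℕ}
    (p : ContDiffHolderFunction ℂ ℂ j r × ContDiffHolderFunction ℂ ℂ j r) {z : ℂ}
    (hz : ‖z‖ ≤ 4) : ‖sec₀ (fun w : ℂ => -w ^ 2) p z‖ ≤ 16 * ‖p‖ := by
  unfold sec₀
  split_ifs
  · calc ‖p.1 z‖ ≤ ‖p‖ := (p.1.norm_apply_le_norm z).trans (norm_fst_le p)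
      _ ≤ 16 * ‖p‖ := le_mul_of_one_le_left (norm_nonneg p) (by norm_num)
  · rw [norm_smul, norm_inv, norm_neg, norm_pow, norm_inv, inv_pow, inv_inv]
    calc ‖z‖ ^ 2 * ‖p.2 z⁻¹‖ ≤ (4 : ℝ) ^ 2 * ‖p‖ :=
          mul_le_mul (pow_le_pow_left₀ (norm_nonneg z) hz 2)
            ((p.2.norm_apply_le_norm _).trans (norm_snd_le p)) (norm_nonneg _) (by positivity)
      _ = 16 * ‖p‖ := by norm_num

/-- **Sup-norm control by the `C^{j,r}`-norm**, `w`-chart: on the disc `‖w‖ ≤ 4` the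
`w`-representative (clutching `-w²`) of a pair of pieces `p` has modulus `≤ 16 ‖p‖`. [folklore] -/
theorem norm_sec₁_le_of_norm_le {j : ℕ}
    (p : ContDiffHolderFunction ℂ ℂ j r × ContDiffHolderFunction ℂ ℂ j r) {w : ℂ}
    (hw : ‖w‖ ≤ 4) : ‖sec₁ (fun w : ℂ => -w ^ 2) p w‖ ≤ 16 * ‖p‖ := by
  unfold sec₁
  split_ifs
  · calc ‖p.2 w‖ ≤ ‖p‖ := (p.2.norm_apply_le_norm w).trans (norm_snd_le p)
      _ ≤ 16 * ‖p‖ := le_mul_of_one_le_left (norm_nonneg p) (by norm_num)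
  · rw [norm_smul, norm_neg, norm_pow]
    calc ‖w‖ ^ 2 * ‖p.1 w⁻¹‖ ≤ (4 : ℝ) ^ 2 * ‖p‖ :=
          mul_le_mul (pow_le_pow_left₀ (norm_nonneg w) hw 2)
            ((p.1.norm_apply_le_norm _).trans (norm_fst_le p)) (norm_nonneg _) (by positivity)
      _ = 16 * ‖p‖ := by norm_num

/-- **A uniform margin**: at a sup-norm small point both representatives stay `≥ μ` below `1/4`
on the (compact) discs of radius `4`, for some `μ > 0` (the continuous moduli attain their
maxima, `contDiff_sec₀` / `contDiff_sec₁`). [folklore] -/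
theorem SmallPt.exists_margin {y : SecPair k r} (hy : SmallPt y) :
    ∃ μ : ℝ, 0 < μ ∧ (∀ z : ℂ, ‖z‖ ≤ 4 → ‖sec₀ (fun w : ℂ => -w ^ 2) y.1.1 z‖ + μ ≤ 4⁻¹) ∧
      (∀ w : ℂ, ‖w‖ ≤ 4 → ‖sec₁ (fun w : ℂ => -w ^ 2) y.1.1 w‖ + μ ≤ 4⁻¹) := by
  have hK : IsCompact (closedBall (0 : ℂ) 4) := isCompact_closedBall 0 4
  have hKne : (closedBall (0 : ℂ) 4).Nonempty := ⟨0, mem_closedBall_self (by norm_num)⟩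
  obtain ⟨z₀, hz₀, hmax₀⟩ := hK.exists_isMaxOn hKne
    (contDiff_sec₀ y.1.2 neg_sq_clutch_ne_zero
      contDiffOn_neg_sq_clutch).continuous.norm.continuousOn
  obtain ⟨w₀, hw₀, hmax₁⟩ := hK.exists_isMaxOn hKne
    (contDiff_sec₁ y.1.2 contDiffOn_neg_sq_clutch).continuous.norm.continuousOn
  rw [mem_closedBall_zero_iff] at hz₀ hw₀
  have hM₀ := hy.1 z₀ hz₀
  have hM₁ := hy.2 w₀ hw₀
  refine ⟨min (4⁻¹ - ‖sec₀ (fun w : ℂ => -w ^ 2) y.1.1 z₀‖)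
      (4⁻¹ - ‖sec₁ (fun w : ℂ => -w ^ 2) y.1.1 w₀‖),
    lt_min (sub_pos.2 hM₀) (sub_pos.2 hM₁), fun z hz => ?_, fun w hw => ?_⟩
  · have h : ‖sec₀ (fun w : ℂ => -w ^ 2) y.1.1 z‖ ≤ ‖sec₀ (fun w : ℂ => -w ^ 2) y.1.1 z₀‖ :=
      isMaxOn_iff.1 hmax₀ z (mem_closedBall_zero_iff.2 hz)
    have h' := min_le_left (4⁻¹ - ‖sec₀ (fun w : ℂ => -w ^ 2) y.1.1 z₀‖)
      (4⁻¹ - ‖sec₁ (fun w : ℂ => -w ^ 2) y.1.1 w₀‖)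
    linarith
  · have h : ‖sec₁ (fun w : ℂ => -w ^ 2) y.1.1 w‖ ≤ ‖sec₁ (fun w : ℂ => -w ^ 2) y.1.1 w₀‖ :=
      isMaxOn_iff.1 hmax₁ w (mem_closedBall_zero_iff.2 hw)
    have h' := min_le_right (4⁻¹ - ‖sec₀ (fun w : ℂ => -w ^ 2) y.1.1 z₀‖)
      (4⁻¹ - ‖sec₁ (fun w : ℂ => -w ^ 2) y.1.1 w₀‖)
    linarith

/-- **The sup-norm small set is open** in `SecPair k r`: a `C^{k+1,r}`-perturbation of size
`< μ / 16` moves both representatives by `< μ` on the discs of radius `4`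
(`norm_sec₀_le_of_norm_le`, `norm_sec₁_le_of_norm_le`), within the margin `μ` of
`SmallPt.exists_margin`. [folklore] -/
theorem isOpen_smallPt : IsOpen {y : SecPair k r | SmallPt y} := by
  rw [Metric.isOpen_iff]
  intro y₀ hy₀
  obtain ⟨μ, hμ, h₀, h₁⟩ := SmallPt.exists_margin hy₀
  refine ⟨μ / 16, by positivity, fun y hy => ⟨fun z hz => ?_, fun w hw => ?_⟩⟩
  · rw [mem_ball, dist_eq_norm] at hy
    have hdec : sec₀ (fun w : ℂ => -w ^ 2) y.1.1 z =
        sec₀ (fun w : ℂ => -w ^ 2) y₀.1.1 z + sec₀ (fun w : ℂ => -w ^ 2) (y - y₀).1.1 z := by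
      rw [Prod.fst_sub, Submodule.coe_sub, sec₀_sub]
      ring
    have hle : ‖sec₀ (fun w : ℂ => -w ^ 2) (y - y₀).1.1 z‖ ≤ 16 * ‖y - y₀‖ :=
      (norm_sec₀_le_of_norm_le _ hz).trans (mul_le_mul_of_nonneg_left
        ((Submodule.norm_coe (y - y₀).1).trans_le (norm_fst_le (y - y₀))) (by norm_num))
    calc ‖sec₀ (fun w : ℂ => -w ^ 2) y.1.1 z‖
        ≤ ‖sec₀ (fun w : ℂ => -w ^ 2) y₀.1.1 z‖ +
            ‖sec₀ (fun w : ℂ => -w ^ 2) (y - y₀).1.1 z‖ := by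
          rw [hdec]
          exact norm_add_le _ _
      _ < 4⁻¹ := by linarith [h₀ z hz]
  · rw [mem_ball, dist_eq_norm] at hy
    have hdec : sec₁ (fun w : ℂ => -w ^ 2) y.1.1 w =
        sec₁ (fun w : ℂ => -w ^ 2) y₀.1.1 w + sec₁ (fun w : ℂ => -w ^ 2) (y - y₀).1.1 w := by
      rw [Prod.fst_sub, Submodule.coe_sub, sec₁_sub_pair]
      ring
    have hle : ‖sec₁ (fun w : ℂ => -w ^ 2) (y - y₀).1.1 w‖ ≤ 16 * ‖y - y₀‖ :=
      (norm_sec₁_le_of_norm_le _ hw).trans (mul_le_mul_of_nonneg_left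
        ((Submodule.norm_coe (y - y₀).1).trans_le (norm_fst_le (y - y₀))) (by norm_num))
    calc ‖sec₁ (fun w : ℂ => -w ^ 2) y.1.1 w‖
        ≤ ‖sec₁ (fun w : ℂ => -w ^ 2) y₀.1.1 w‖ +
            ‖sec₁ (fun w : ℂ => -w ^ 2) (y - y₀).1.1 w‖ := by
          rw [hdec]
          exact norm_add_le _ _
      _ < 4⁻¹ := by linarith [h₁ w hw]

/-- The sup-norm small set is a neighbourhood of each of its points. [folklore] -/
theorem smallPt_mem_nhds {y : SecPair k r} (hy : SmallPt y) :
    {y' : SecPair k r | SmallPt y'} ∈ 𝓝 y :=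
  isOpen_smallPt.mem_nhds hy

/-- The sup-norm small set is a neighbourhood of the zero section. [folklore] -/
theorem smallPt_mem_nhds_zero : {y : SecPair k r | SmallPt y} ∈ 𝓝 (0 : SecPair k r) :=
  smallPt_mem_nhds smallPt_zero

end SmallPt

/-! ### The outputs are the honest operators at a sup-norm small point -/

section Honest

variable {hr k}

/-- **At a sup-norm small point the chart-`0` output is the honest operator**:
`out₀ y z = ρ z • crOp₀ (sec₀ ξ) (sec₀ f) z` for `‖z‖ < 4`. [cite: Wendl2018, Thm. 2.46] -/
theorem out₀_apply_of_smallPt {y : SecPair k r} (hy : SmallPt y) {z : ℂ} (hz : ‖z‖ < 4) :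
    𝒥.out₀ hr k y z =
      rhoCut z • 𝒥.crOp₀ (sec₀ (fun w : ℂ => -w ^ 2) y.1.1) (sec₀ (1 : ℂ → ℂ) y.2.1) z := by
  have hc : ‖sec₀ (fun w : ℂ => -w ^ 2) y.1.1 z‖ ≤ 1 :=
    (hy.1 z hz.le).le.trans (by norm_num)
  have hden : den z (sec₀ (fun w : ℂ => -w ^ 2) y.1.1 z) ≠ 0 :=
    den_ne_zero_of_norm_lt_two (hc.trans_lt (by norm_num))
  rw [out₀_apply, jets₀_apply_of_norm_lt hr k y hz, 𝒥.phiCut₀_eq_jetOp₀ hc,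
    𝒥.crOp₀_eq_jetOp₀ (differentiableAt_sec₀_T y z) (differentiableAt_sec₀_N y z) hden]

/-- **At a sup-norm small point the chart-`1` output is the honest operator**:
`out₁ y w = ρ w • crOp₁ (sec₁ ξ) (sec₁ f) w` for `‖w‖ < 4`. [cite: Wendl2018, Thm. 2.46] -/
theorem out₁_apply_of_smallPt {y : SecPair k r} (hy : SmallPt y) {w : ℂ} (hw : ‖w‖ < 4) :
    𝒥.out₁ hr k y w =
      rhoCut w • 𝒥.crOp₁ (sec₁ (fun w : ℂ => -w ^ 2) y.1.1) (sec₁ (1 : ℂ → ℂ) y.2.1) w := by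
  have hc : ‖sec₁ (fun w : ℂ => -w ^ 2) y.1.1 w‖ ≤ 1 :=
    (hy.2 w hw.le).le.trans (by norm_num)
  have hden : den w (sec₁ (fun w : ℂ => -w ^ 2) y.1.1 w) ≠ 0 :=
    den_ne_zero_of_norm_lt_two (hc.trans_lt (by norm_num))
  rw [out₁_apply, jets₁_apply_of_norm_lt hr k y hw, 𝒥.phiCut₁_eq_jetOp₁ hc,
    𝒥.crOp₁_eq_jetOp₁ (differentiableAt_sec₁_T y w) (differentiableAt_sec₁_N y w) hden]

/-- **The clutching law for the honest operators at a sup-norm small point**, at `z ≠ 0` with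
`1/3 ≤ ‖z‖ < 4`. [cite: Wendl2018, Thm. 2.46] -/
theorem crOp₁_eq_of_smallPt {y : SecPair k r} (hy : SmallPt y) {z : ℂ} (hz0 : z ≠ 0)
    (hz3 : 3⁻¹ ≤ ‖z‖) (hz4 : ‖z‖ < 4) :
    𝒥.crOp₁ (sec₁ (fun w : ℂ => -w ^ 2) y.1.1) (sec₁ (1 : ℂ → ℂ) y.2.1) z⁻¹ =
      ((z⁻¹ ^ 2 * ((starRingEnd ℂ) z⁻¹)⁻¹ ^ 2) *
          (𝒥.crOp₀ (sec₀ (fun w : ℂ => -w ^ 2) y.1.1) (sec₀ (1 : ℂ → ℂ) y.2.1) z).1,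
        (-((starRingEnd ℂ) z⁻¹)⁻¹ ^ 2) *
          (𝒥.crOp₀ (sec₀ (fun w : ℂ => -w ^ 2) y.1.1) (sec₀ (1 : ℂ → ℂ) y.2.1) z).2) := by
  have hne : ∀ᶠ w in 𝓝 z⁻¹, w ≠ 0 := isOpen_ne.mem_nhds (inv_ne_zero hz0)
  have hξ : sec₁ (fun w : ℂ => -w ^ 2) y.1.1 =ᶠ[𝓝 z⁻¹]
      fun w => -w ^ 2 * sec₀ (fun w : ℂ => -w ^ 2) y.1.1 w⁻¹ := by
    filter_upwards [hne] with w hw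
    rw [sec₁_eq_smul_sec₀ y.1.2 neg_sq_clutch_ne_zero hw, smul_eq_mul]
  have hf : sec₁ (1 : ℂ → ℂ) y.2.1 =ᶠ[𝓝 z⁻¹] fun w => sec₀ (1 : ℂ → ℂ) y.2.1 w⁻¹ := by
    filter_upwards [hne] with w hw
    rw [sec₁_eq_smul_sec₀ y.2.2 one_clutch_ne_zero hw, Pi.one_apply, one_smul]
  have hc := hy.1 z hz4.le
  exact 𝒥.crOp₁_eq hz0 (differentiableAt_sec₀_T y z) (differentiableAt_sec₀_N y z) hξ hf
    (den_ne_zero_of_norm_lt_two (hc.trans (by norm_num))) (num_ne_zero_of_norm hz3 hc)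

/-! ### Membership of the pieces in the section spaces at a sup-norm small point -/

/-- **Membership of the normal pieces at a sup-norm small point**:
`PN y ∈ 𝓗^{k,r}_{dbarClutch 1}` (the clutching law `crOp₁_eq_of_smallPt`).
[cite: Wendl2018, Thm. 2.46] -/
theorem PN_mem_of_smallPt {y : SecPair k r} (hy : SmallPt y) :
    𝒥.PN hr k y ∈ holderSections ℂ (dbarClutch (1 : ℂ → ℂ)) k r := by
  refine ⟨fun z hz => ?_, fun w hw => ?_⟩
  · -- piece relation (i) at `z`, `1/2 ≤ ‖z‖`
    by_cases h3 : 3 ≤ ‖z‖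
    · rw [PN_fst_apply, PN_snd_apply, 𝒥.out₀_apply_of_le hr k y h3, rhoCut_eq_zero h3]
      simp
    · rw [not_le] at h3
      have hz0 : z ≠ 0 := ne_zero_of_half_le_norm hz
      have hw2 : ‖z⁻¹‖ ≤ 2 := norm_inv_le_two_of_half_le hz
      have hcl := 𝒥.crOp₁_eq_of_smallPt hy hz0 (le_trans (by norm_num) hz)
        (h3.trans (by norm_num))
      rw [PN_fst_apply, PN_snd_apply, 𝒥.out₀_apply_of_smallPt hy (h3.trans (by norm_num)),
        𝒥.out₁_apply_of_smallPt hy (hw2.trans_lt (by norm_num)), rhoCut_eq_one hw2, one_smul,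
        hcl, Prod.smul_snd]
      have hτ : dbarClutch (1 : ℂ → ℂ) z⁻¹ ≠ 0 :=
        dbarClutch_ne_zero_of one_clutch_ne_zero z⁻¹ (inv_ne_zero hz0)
      simp only [dbarClutch, Pi.one_apply, one_mul, smul_eq_mul, Complex.real_smul] at hτ ⊢
      rw [mul_assoc, inv_mul_cancel_left₀ hτ]
  · -- piece relation (ii) at `w`, `1/2 ≤ ‖w‖`
    by_cases h3 : 3 ≤ ‖w‖
    · rw [PN_fst_apply, PN_snd_apply, 𝒥.out₁_apply_of_le hr k y h3, rhoCut_eq_zero h3]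
      simp
    · rw [not_le] at h3
      have hw0 : w ≠ 0 := ne_zero_of_half_le_norm hw
      have hz2 : ‖w⁻¹‖ ≤ 2 := norm_inv_le_two_of_half_le hw
      have hz3 : 3⁻¹ ≤ ‖w⁻¹‖ := by
        rw [norm_inv]
        exact (inv_le_inv₀ (by norm_num) (norm_pos_iff.2 hw0)).2 h3.le |>.trans_eq' (by norm_num)
      have hcl := 𝒥.crOp₁_eq_of_smallPt hy (inv_ne_zero hw0) hz3 (hz2.trans_lt (by norm_num))
      rw [inv_inv] at hcl
      rw [PN_fst_apply, PN_snd_apply, 𝒥.out₁_apply_of_smallPt hy (h3.trans (by norm_num)),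
        𝒥.out₀_apply_of_smallPt hy (hz2.trans_lt (by norm_num)), rhoCut_eq_one hz2, one_smul,
        hcl, Prod.smul_snd]
      simp only [dbarClutch, Pi.one_apply, one_mul, smul_eq_mul, Complex.real_smul]
      ring

/-- **Membership of the tangent pieces at a sup-norm small point**:
`PT y ∈ 𝓗^{k,r}_{dbarClutch (-w²)}`. [cite: Wendl2018, Thm. 2.46] -/
theorem PT_mem_of_smallPt {y : SecPair k r} (hy : SmallPt y) :
    𝒥.PT hr k y ∈ holderSections ℂ (dbarClutch (fun w : ℂ => -w ^ 2)) k r := by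
  refine ⟨fun z hz => ?_, fun w hw => ?_⟩
  · by_cases h3 : 3 ≤ ‖z‖
    · rw [PT_fst_apply, PT_snd_apply, 𝒥.out₀_apply_of_le hr k y h3, rhoCut_eq_zero h3]
      simp
    · rw [not_le] at h3
      have hz0 : z ≠ 0 := ne_zero_of_half_le_norm hz
      have hw2 : ‖z⁻¹‖ ≤ 2 := norm_inv_le_two_of_half_le hz
      have hcl := 𝒥.crOp₁_eq_of_smallPt hy hz0 (le_trans (by norm_num) hz)
        (h3.trans (by norm_num))
      rw [PT_fst_apply, PT_snd_apply, 𝒥.out₀_apply_of_smallPt hy (h3.trans (by norm_num)),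
        𝒥.out₁_apply_of_smallPt hy (hw2.trans_lt (by norm_num)), rhoCut_eq_one hw2, one_smul,
        hcl, Prod.smul_fst]
      have hτ : dbarClutch (fun w : ℂ => -w ^ 2) z⁻¹ ≠ 0 :=
        dbarClutch_ne_zero_of neg_sq_clutch_ne_zero z⁻¹ (inv_ne_zero hz0)
      simp only [dbarClutch, neg_mul, neg_neg, smul_eq_mul, Complex.real_smul] at hτ ⊢
      rw [mul_assoc, inv_mul_cancel_left₀ hτ]
  · by_cases h3 : 3 ≤ ‖w‖
    · rw [PT_fst_apply, PT_snd_apply, 𝒥.out₁_apply_of_le hr k y h3, rhoCut_eq_zero h3]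
      simp
    · rw [not_le] at h3
      have hw0 : w ≠ 0 := ne_zero_of_half_le_norm hw
      have hz2 : ‖w⁻¹‖ ≤ 2 := norm_inv_le_two_of_half_le hw
      have hz3 : 3⁻¹ ≤ ‖w⁻¹‖ := by
        rw [norm_inv]
        exact (inv_le_inv₀ (by norm_num) (norm_pos_iff.2 hw0)).2 h3.le |>.trans_eq' (by norm_num)
      have hcl := 𝒥.crOp₁_eq_of_smallPt hy (inv_ne_zero hw0) hz3 (hz2.trans_lt (by norm_num))
      rw [inv_inv] at hcl
      rw [PT_fst_apply, PT_snd_apply, 𝒥.out₁_apply_of_smallPt hy (h3.trans (by norm_num)),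
        𝒥.out₀_apply_of_smallPt hy (hz2.trans_lt (by norm_num)), rhoCut_eq_one hz2, one_smul,
        hcl, Prod.smul_fst]
      simp only [dbarClutch, smul_eq_mul, Complex.real_smul]
      ring

/-! ### `FT`, `FN` on the sup-norm small set -/

/-- On the sup-norm small set `FT` is `PT`. [folklore] -/
theorem coe_FT_of_smallPt {y : SecPair k r} (hy : SmallPt y) :
    ((𝒥.FT hr k y : holderSections ℂ (dbarClutch (fun w : ℂ => -w ^ 2)) k r) :
      ContDiffHolderFunction ℂ ℂ k r × ContDiffHolderFunction ℂ ℂ k r) = 𝒥.PT hr k y := by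
  unfold FT
  rw [dif_pos (𝒥.PT_mem_of_smallPt hy)]

/-- On the sup-norm small set `FN` is `PN`. [folklore] -/
theorem coe_FN_of_smallPt {y : SecPair k r} (hy : SmallPt y) :
    ((𝒥.FN hr k y : holderSections ℂ (dbarClutch (1 : ℂ → ℂ)) k r) :
      ContDiffHolderFunction ℂ ℂ k r × ContDiffHolderFunction ℂ ℂ k r) = 𝒥.PN hr k y := by
  unfold FN
  rw [dif_pos (𝒥.PN_mem_of_smallPt hy)]

end Honest

/-- **`FT` is `C^∞` on the sup-norm small set** (a `C^∞` map with values in a closed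
submodule, `contDiffOn_of_linearIsometry_comp`). [folklore] -/
theorem contDiffOn_FT_smallPt : ContDiffOn ℝ ∞ (𝒥.FT hr k) {y : SecPair k r | SmallPt y} := by
  refine contDiffOn_of_linearIsometry_comp (𝕜 := ℝ)
    (holderSections ℂ (dbarClutch (fun w : ℂ => -w ^ 2)) k r).subtypeₗᵢ
    (by rw [range_subtypeₗᵢ]; exact isClosed_holderSections)
    isOpen_smallPt.uniqueDiffOn ?_
  exact (𝒥.contDiff_PT hr k).contDiffOn.congr fun y hy => 𝒥.coe_FT_of_smallPt hy

/-- **`FN` is `C^∞` on the sup-norm small set.** [folklore] -/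
theorem contDiffOn_FN_smallPt : ContDiffOn ℝ ∞ (𝒥.FN hr k) {y : SecPair k r | SmallPt y} := by
  refine contDiffOn_of_linearIsometry_comp (𝕜 := ℝ)
    (holderSections ℂ (dbarClutch (1 : ℂ → ℂ)) k r).subtypeₗᵢ
    (by rw [range_subtypeₗᵢ]; exact isClosed_holderSections)
    isOpen_smallPt.uniqueDiffOn ?_
  exact (𝒥.contDiff_PN hr k).contDiffOn.congr fun y hy => 𝒥.coe_FN_of_smallPt hy

/-! ### The derivative at a general sup-norm small point -/

/-- At a sup-norm small point `y` the derivative `dPT y` takes values in `𝓗T'` (the values of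
`PT` near `y` do, and the submodule is closed). [folklore] -/
theorem dPT_mem_of_smallPt {y : SecPair k r} (hy : SmallPt y) (δ : SecPair k r) :
    𝒥.dPT hr k y δ ∈ holderSections ℂ (dbarClutch (fun w : ℂ => -w ^ 2)) k r :=
  mem_of_hasFDerivAt_of_isClosed (𝕜 := ℝ) _ isClosed_holderSections (𝒥.hasFDerivAt_PT hr k y)
    (Filter.mem_of_superset (smallPt_mem_nhds hy) fun _ hy' => 𝒥.PT_mem_of_smallPt hy') δ

/-- At a sup-norm small point `y` the derivative `dPN y` takes values in `𝓗N'`. [folklore] -/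
theorem dPN_mem_of_smallPt {y : SecPair k r} (hy : SmallPt y) (δ : SecPair k r) :
    𝒥.dPN hr k y δ ∈ holderSections ℂ (dbarClutch (1 : ℂ → ℂ)) k r :=
  mem_of_hasFDerivAt_of_isClosed (𝕜 := ℝ) _ isClosed_holderSections (𝒥.hasFDerivAt_PN hr k y)
    (Filter.mem_of_superset (smallPt_mem_nhds hy) fun _ hy' => 𝒥.PN_mem_of_smallPt hy') δ

/-- **The tangent linearisation at a sup-norm small point** `LTAt y = D FT (y) : SecPair k r →L 𝓗T'`
(the codomain restriction of `dPT y`). [cite: Wendl2018, Thm. 2.46] -/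
def LTAt (y : SecPair k r) (hy : SmallPt y) :
    SecPair k r →L[ℝ] holderSections ℂ (dbarClutch (fun w : ℂ => -w ^ 2)) k r :=
  (𝒥.dPT hr k y).codRestrict _ (𝒥.dPT_mem_of_smallPt hr k hy)

/-- **The normal linearisation at a sup-norm small point** `LNAt y = D FN (y) : SecPair k r →L 𝓗N'`.
[cite: Wendl2018, Thm. 2.46] -/
def LNAt (y : SecPair k r) (hy : SmallPt y) :
    SecPair k r →L[ℝ] holderSections ℂ (dbarClutch (1 : ℂ → ℂ)) k r :=
  (𝒥.dPN hr k y).codRestrict _ (𝒥.dPN_mem_of_smallPt hr k hy)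

/-- Values of `LTAt`. [folklore] -/
@[simp] theorem coe_LTAt {y : SecPair k r} (hy : SmallPt y) (δ : SecPair k r) :
    ((𝒥.LTAt hr k y hy δ : holderSections ℂ (dbarClutch (fun w : ℂ => -w ^ 2)) k r) :
      ContDiffHolderFunction ℂ ℂ k r × ContDiffHolderFunction ℂ ℂ k r) = 𝒥.dPT hr k y δ := rfl

/-- Values of `LNAt`. [folklore] -/
@[simp] theorem coe_LNAt {y : SecPair k r} (hy : SmallPt y) (δ : SecPair k r) :
    ((𝒥.LNAt hr k y hy δ : holderSections ℂ (dbarClutch (1 : ℂ → ℂ)) k r) :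
      ContDiffHolderFunction ℂ ℂ k r × ContDiffHolderFunction ℂ ℂ k r) = 𝒥.dPN hr k y δ := rfl

/-- At the zero section `LTAt` is the lead's `LT`. [folklore] -/
theorem LTAt_zero : 𝒥.LTAt hr k 0 smallPt_zero = 𝒥.LT hr k := rfl

/-- At the zero section `LNAt` is the lead's `LN`. [folklore] -/
theorem LNAt_zero : 𝒥.LNAt hr k 0 smallPt_zero = 𝒥.LN hr k := rfl

/-- **`FT` has derivative `LTAt y` at every sup-norm small point `y`.**
[cite: Wendl2018, Thm. 2.46] -/
theorem hasFDerivAt_FT_of_smallPt {y : SecPair k r} (hy : SmallPt y) :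
    HasFDerivAt (𝒥.FT hr k) (𝒥.LTAt hr k y hy) y := by
  refine (hasFDerivAt_linearIsometry_comp_iff (𝕜 := ℝ)
    (holderSections ℂ (dbarClutch (fun w : ℂ => -w ^ 2)) k r).subtypeₗᵢ).1 ?_
  have h1 : (holderSections ℂ (dbarClutch (fun w : ℂ => -w ^ 2)) k
      r).subtypeₗᵢ.toContinuousLinearMap.comp (𝒥.LTAt hr k y hy) = 𝒥.dPT hr k y :=
    ContinuousLinearMap.ext fun _ => rfl
  rw [h1]
  refine (𝒥.hasFDerivAt_PT hr k y).congr_of_eventuallyEq ?_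
  filter_upwards [smallPt_mem_nhds hy] with y' hy'
  exact 𝒥.coe_FT_of_smallPt hy'

/-- **`FN` has derivative `LNAt y` at every sup-norm small point `y`.**
[cite: Wendl2018, Thm. 2.46] -/
theorem hasFDerivAt_FN_of_smallPt {y : SecPair k r} (hy : SmallPt y) :
    HasFDerivAt (𝒥.FN hr k) (𝒥.LNAt hr k y hy) y := by
  refine (hasFDerivAt_linearIsometry_comp_iff (𝕜 := ℝ)
    (holderSections ℂ (dbarClutch (1 : ℂ → ℂ)) k r).subtypeₗᵢ).1 ?_
  have h1 : (holderSections ℂ (dbarClutch (1 : ℂ → ℂ)) k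
      r).subtypeₗᵢ.toContinuousLinearMap.comp (𝒥.LNAt hr k y hy) = 𝒥.dPN hr k y :=
    ContinuousLinearMap.ext fun _ => rfl
  rw [h1]
  refine (𝒥.hasFDerivAt_PN hr k y).congr_of_eventuallyEq ?_
  filter_upwards [smallPt_mem_nhds hy] with y' hy'
  exact 𝒥.coe_FN_of_smallPt hy'

/-- The Fréchet derivative of `FT` at a sup-norm small point is `LTAt`. [folklore] -/
theorem fderiv_FT_of_smallPt {y : SecPair k r} (hy : SmallPt y) :
    fderiv ℝ (𝒥.FT hr k) y = 𝒥.LTAt hr k y hy :=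
  (𝒥.hasFDerivAt_FT_of_smallPt hr k hy).fderiv

/-- The Fréchet derivative of `FN` at a sup-norm small point is `LNAt`. [folklore] -/
theorem fderiv_FN_of_smallPt {y : SecPair k r} (hy : SmallPt y) :
    fderiv ℝ (𝒥.FN hr k) y = 𝒥.LNAt hr k y hy :=
  (𝒥.hasFDerivAt_FN_of_smallPt hr k hy).fderiv

end SphereACData

end SphereCR

end Literature.Geometry.Symplectic

end
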